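import Literature.Analysis.FluidPDE.ESSLocalHolderBlowupLimit
import HarnessLib

/-!
# Compactness of suitable weak solutions on expanding parabolic balls (Albritton–Barker 2019, Lemma 2.2, slab form)

Analysis/FluidPDE proofs-only file (theorems only: no definitions, no named facts, no `sorry`)
over `Literature/Analysis/FluidPDE/LocalTypeI.lean` (D. Albritton, T. Barker, *On local Type I
singularities of the Navier–Stokes equations and Liouville theorems*, J. Math. Fluid Mech. 21
(2019) = arXiv:1811.00502, Lemma 2.2 after F.-H. Lin, CPAM 51 (1998), Thm. 2.2; the bookkeeping
of G. Seregin, *Lecture Notes on Regularity Theory for the Navier–Stokes Equations* (2014),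
Prop. 6.20: "for each `a > 0`, `u^{(k)} → u` in `L₃(Q(a))` … `p^{(k)} ⇀ p` in `L_{3/2}(Q(a))`").

The tree's compactness theorem `SuitableCompactness_holds` (A–B Lemma 2.2) extracts, from a
sequence of suitable weak solutions on the **unit** parabolic ball `Q = Q(0, 1)` with a uniform
`L³ × L^{3/2}` bound, a subsequence converging on the balls `Q(0, R)`, `R < 1`.  Blow-up and
blow-down arguments on the backward slab `ℝ³ × ℝ₋` (A–B §3; Seregin 2014, §6.6) need the version
on the **expanding balls `Q(0, a)`, `a > 0`**, for sequences which are suitable on every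
`Q(0, 2ᵐ)` with uniform bounds there:

* `slab_suitableCompactness` — if `(v_k, q_k)` are suitable weak solutions in every ball
  `Q(0, 2ᵐ)` (A–B Def. 2.1, `IsSuitableWeakSolutionInBall (2^m) 0`) with
  `sup_k ‖v_k‖_{L³(Q(0,2ᵐ))} + ‖q_k‖_{L^{3/2}(Q(0,2ᵐ))} < ∞` for every `m`, then along ONE
  subsequence `σ` and for ONE pair `(u, p)`: for every `a > 0`, `(u, p)` is a suitable weak
  solution in `Q(0, a)`, `u ∈ L³(Q(0, a))`, `v_{σ j} → u` in `L³(Q(0, a))` and `q_{σ j} ⇀ p`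
  weakly in `L^{3/2}(Q(0, a))` (tested against `L³(Q(0, a))`).

Proof (the scheme of `ESSLocalHolderBlowupExtraction` / `ESSLocalHolderBlowupLimit`): at level
`m` the zoom-outs `2ᵐ v_k(4ᵐ s, 2ᵐ y)` are suitable on the unit ball with a uniform bound
(`IsSuitableWeakSolutionInBall.zoomOut`, `eLpNorm_uncurry_zoom`), so `SuitableCompactness_holds`
extracts at each level; Cantor's diagonal procedure
(`FunctionSpaces.exists_strictMono_forall_of_extraction`) gives one subsequence good at all
levels; the level limits, zoomed back, are limits of the same sequence on `Q(0, 2ᵐ R)`, hence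
agree a.e. by uniqueness of strong `L³` and weak limits (`ae_eq_of_tendsto_eLpNorm_sub`,
`ae_eq_of_forall_setIntegral_mul_eq`) and glue along the exhaustion `Q(0, 2ᵐ/2)`.

## References

* D. Albritton, T. Barker, J. Math. Fluid Mech. 21 (2019), no. 43 = arXiv:1811.00502, Lemma 2.2,
  §3. [AlbrittonBarker2019]
* F.-H. Lin, Comm. Pure Appl. Math. 51 (1998), Thm. 2.2. [Lin1998]
* G. Seregin, *Lecture Notes on Regularity Theory for the Navier–Stokes Equations*, World
  Scientific (2014), §6.6, Prop. 6.20. [Seregin2014]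
-/

noncomputable section

open MeasureTheory Set Function Filter Topology TopologicalSpace Metric
open scoped NNReal ENNReal

namespace Literature.Analysis.FluidPDE

section SlabCompactness

variable {v : ℕ → ℝ → EuclideanSpace ℝ (Fin 3) → EuclideanSpace ℝ (Fin 3)}
  {q : ℕ → ℝ → EuclideanSpace ℝ (Fin 3) → ℝ}

/-- **One subsequence at all levels.**  If `(v_k, q_k)` are suitable weak solutions in every
ball `Q(0, 2ᵐ)` with a uniform `L³ × L^{3/2}` bound on each of them, there is one strictly
increasing `σ` such that for every level `m` the zoom-outs `2ᵐ v_{σ j}(4ᵐ s, 2ᵐ y)`,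
`4ᵐ q_{σ j}(4ᵐ s, 2ᵐ y)` converge on the balls `Q(0, R)`, `R < 1`, as in A–B Lemma 2.2 to a pair
`(u_m, p_m)` which is suitable in every such ball (`SuitableCompactness_holds` at each level and
the diagonal procedure `FunctionSpaces.exists_strictMono_forall_of_extraction`).
[cite: AlbrittonBarker2019, Lemma 2.2] -/
theorem slab_suitableCompactness_levels
    (hball : ∀ k (m : ℕ), IsSuitableWeakSolutionInBall ((2 : ℝ) ^ m) 0 (v k) (q k))
    (hbd : ∀ m : ℕ, (⨆ k, eLpNorm (uncurry (v k)) 3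
        (volume.restrict (parabolicCylinder ((2 : ℝ) ^ m) (0 : ℝ × EuclideanSpace ℝ (Fin 3)))) +
      eLpNorm (uncurry (q k)) (3 / 2)
        (volume.restrict (parabolicCylinder ((2 : ℝ) ^ m) (0 : ℝ × EuclideanSpace ℝ (Fin 3))))) < ∞) :
    ∃ σ : ℕ → ℕ, StrictMono σ ∧ ∀ m : ℕ,
      ∃ (u : ℝ → EuclideanSpace ℝ (Fin 3) → EuclideanSpace ℝ (Fin 3))
        (p : ℝ → EuclideanSpace ℝ (Fin 3) → ℝ), ∀ R ∈ Ioo (0 : ℝ) 1,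
        IsSuitableWeakSolutionInBall R 0 u p ∧
        MemLp (uncurry u) 3
          (volume.restrict (parabolicCylinder R (0 : ℝ × EuclideanSpace ℝ (Fin 3)))) ∧
        Tendsto (fun j => eLpNorm
            (uncurry (((2 : ℝ) ^ m) • stPull (((2 : ℝ) ^ m) ^ 2) ((2 : ℝ) ^ m) (0 : ℝ)
              (0 : EuclideanSpace ℝ (Fin 3)) (v (σ j))) - uncurry u) 3
            (volume.restrict (parabolicCylinder R (0 : ℝ × EuclideanSpace ℝ (Fin 3)))))
          atTop (𝓝 0) ∧
        ∀ g : ℝ × EuclideanSpace ℝ (Fin 3) → ℝ,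
          MemLp g 3 (volume.restrict (parabolicCylinder R (0 : ℝ × EuclideanSpace ℝ (Fin 3)))) →
          Tendsto (fun j => ∫ w in parabolicCylinder R (0 : ℝ × EuclideanSpace ℝ (Fin 3)),
              (((2 : ℝ) ^ m) ^ 2 • stPull (((2 : ℝ) ^ m) ^ 2) ((2 : ℝ) ^ m) (0 : ℝ)
                (0 : EuclideanSpace ℝ (Fin 3)) (q (σ j))) w.1 w.2 * g w)
            atTop (𝓝 (∫ w in parabolicCylinder R (0 : ℝ × EuclideanSpace ℝ (Fin 3)),
              p w.1 w.2 * g w)) := by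
  classical
  -- ## abbreviations
  set cc : ℕ → ℝ := fun m => (2 : ℝ) ^ m with hcc
  have hcc_pos : ∀ m, 0 < cc m := fun m => by positivity
  set Vz : ℕ → ℕ → ℝ → EuclideanSpace ℝ (Fin 3) → EuclideanSpace ℝ (Fin 3) :=
    fun m k => cc m • stPull (cc m ^ 2) (cc m) (0 : ℝ) (0 : EuclideanSpace ℝ (Fin 3)) (v k) with hVz
  set Qz : ℕ → ℕ → ℝ → EuclideanSpace ℝ (Fin 3) → ℝ :=
    fun m k => cc m ^ 2 • stPull (cc m ^ 2) (cc m) (0 : ℝ) (0 : EuclideanSpace ℝ (Fin 3)) (q k) with hQz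
  set μ : ℝ → Measure (ℝ × EuclideanSpace ℝ (Fin 3)) :=
    fun R => volume.restrict (parabolicCylinder R (0 : ℝ × EuclideanSpace ℝ (Fin 3))) with hμ
  set Good : ℕ → (ℕ → ℕ) →
      ((ℝ → EuclideanSpace ℝ (Fin 3) → EuclideanSpace ℝ (Fin 3)) ×
        (ℝ → EuclideanSpace ℝ (Fin 3) → ℝ)) → Prop :=
    fun m ρ d => ∀ R ∈ Ioo (0 : ℝ) 1,
      IsSuitableWeakSolutionInBall R 0 d.1 d.2 ∧ MemLp (uncurry d.1) 3 (μ R) ∧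
      Tendsto (fun j => eLpNorm (uncurry (Vz m (ρ j)) - uncurry d.1) 3 (μ R)) atTop (𝓝 0) ∧
      ∀ g : ℝ × EuclideanSpace ℝ (Fin 3) → ℝ, MemLp g 3 (μ R) →
        Tendsto (fun j => ∫ w in parabolicCylinder R (0 : ℝ × EuclideanSpace ℝ (Fin 3)),
            (Qz m (ρ j)) w.1 w.2 * g w) atTop
          (𝓝 (∫ w in parabolicCylinder R (0 : ℝ × EuclideanSpace ℝ (Fin 3)), d.2 w.1 w.2 * g w))
    with hGood
  -- ## goodness is stable under eventual subsequences
  have hsub : ∀ m (φ φ' : ℕ → ℕ), (∃ τ : ℕ → ℕ, StrictMono τ ∧ ∀ᶠ k in atTop, φ' k = φ (τ k)) →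
      (∃ d, Good m φ d) → ∃ d, Good m φ' d := by
    rintro m φ φ' ⟨τ, hτ, heq⟩ ⟨d, hg⟩
    refine ⟨d, fun R hR => ?_⟩
    obtain ⟨h1, h2, h3, h4⟩ := hg R hR
    exact ⟨h1, h2, FunctionSpaces.tendsto_of_eventually_eq_comp
        (a := fun k => eLpNorm (uncurry (Vz m k) - uncurry d.1) 3 (μ R)) hτ heq h3,
      fun g hg' => FunctionSpaces.tendsto_of_eventually_eq_comp
        (a := fun k => ∫ w in parabolicCylinder R (0 : ℝ × EuclideanSpace ℝ (Fin 3)),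
          (Qz m k) w.1 w.2 * g w) hτ heq (h4 g hg')⟩
  -- ## extraction at one level (the compactness theorem on the unit ball)
  have hex : ∀ m (φ : ℕ → ℕ), StrictMono φ → ∃ ψ : ℕ → ℕ, StrictMono ψ ∧ ∃ d, Good m (φ ∘ ψ) d := by
    intro m φ _hφ
    have hone : cc m / cc m = 1 := div_self (hcc_pos m).ne'
    have hsuit : ∀ k, IsSuitableWeakSolutionInBall 1 0 (Vz m (φ k)) (Qz m (φ k)) := by
      intro k
      have h := (hball (φ k) m).zoomOut (hcc_pos m)
      rwa [hone] at h
    -- the uniform bound on the unit ball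
    set K₁ : ℝ≥0∞ := ‖cc m‖ₑ *
      (ENNReal.ofReal (cc m ^ 2 * cc m ^ 3)⁻¹) ^ (1 / (3 : ℝ≥0∞).toReal) with hK₁
    set K₂ : ℝ≥0∞ := ‖cc m ^ 2‖ₑ *
      (ENNReal.ofReal (cc m ^ 2 * cc m ^ 3)⁻¹) ^ (1 / (3 / 2 : ℝ≥0∞).toReal) with hK₂
    have hK₁top : K₁ ≠ ∞ := ENNReal.mul_ne_top enorm_ne_top
      (ENNReal.rpow_ne_top_of_nonneg (by positivity) ENNReal.ofReal_ne_top)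
    have hK₂top : K₂ ≠ ∞ := ENNReal.mul_ne_top enorm_ne_top
      (ENNReal.rpow_ne_top_of_nonneg (by positivity) ENNReal.ofReal_ne_top)
    set S : ℝ≥0∞ := ⨆ k, eLpNorm (uncurry (v k)) 3 (μ (cc m)) +
      eLpNorm (uncurry (q k)) (3 / 2) (μ (cc m)) with hS
    have hStop : S ≠ ∞ := (hbd m).ne
    have hbound : (⨆ k, eLpNorm (uncurry (Vz m (φ k))) 3 (μ 1) +
        eLpNorm (uncurry (Qz m (φ k))) (3 / 2) (μ 1)) < ∞ := by
      refine lt_of_le_of_lt (iSup_le fun k => ?_) (ENNReal.mul_lt_top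
        (ENNReal.add_lt_top.2 ⟨hK₁top.lt_top, hK₂top.lt_top⟩) hStop.lt_top)
      have hle : eLpNorm (uncurry (v (φ k))) 3 (μ (cc m)) +
          eLpNorm (uncurry (q (φ k))) (3 / 2) (μ (cc m)) ≤ S :=
        le_iSup (fun k => eLpNorm (uncurry (v k)) 3 (μ (cc m)) +
          eLpNorm (uncurry (q k)) (3 / 2) (μ (cc m))) (φ k)
      have e1 : eLpNorm (uncurry (Vz m (φ k))) 3 (μ 1) =
          K₁ * eLpNorm (uncurry (v (φ k))) 3 (μ (cc m)) := by
        show eLpNorm _ 3 (volume.restrict (parabolicCylinder 1 0)) = _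
        rw [← hone]
        exact eLpNorm_uncurry_zoom (hcc_pos m) (cc m) (v (φ k)) (cc m) (by norm_num) (by norm_num)
      have e2 : eLpNorm (uncurry (Qz m (φ k))) (3 / 2) (μ 1) =
          K₂ * eLpNorm (uncurry (q (φ k))) (3 / 2) (μ (cc m)) := by
        show eLpNorm _ (3 / 2) (volume.restrict (parabolicCylinder 1 0)) = _
        rw [← hone]
        exact eLpNorm_uncurry_zoom (hcc_pos m) (cc m ^ 2) (q (φ k)) (cc m) (by norm_num)
          (ENNReal.div_ne_top (by norm_num) (by norm_num))
      rw [e1, e2]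
      calc K₁ * eLpNorm (uncurry (v (φ k))) 3 (μ (cc m)) +
            K₂ * eLpNorm (uncurry (q (φ k))) (3 / 2) (μ (cc m))
          ≤ (K₁ + K₂) * eLpNorm (uncurry (v (φ k))) 3 (μ (cc m)) +
            (K₁ + K₂) * eLpNorm (uncurry (q (φ k))) (3 / 2) (μ (cc m)) := by
            gcongr <;> simp
        _ = (K₁ + K₂) * (eLpNorm (uncurry (v (φ k))) 3 (μ (cc m)) +
            eLpNorm (uncurry (q (φ k))) (3 / 2) (μ (cc m))) := by rw [mul_add]
        _ ≤ (K₁ + K₂) * S := by gcongr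
    obtain ⟨u, p, ψ, hψ, hconv⟩ :=
      SuitableCompactness_holds (fun k => Vz m (φ k)) (fun k => Qz m (φ k)) hsuit hbound
    exact ⟨ψ, hψ, (u, p), fun R hR => hconv R hR⟩
  -- ## the diagonal
  obtain ⟨σ, hσ, hgood⟩ := FunctionSpaces.exists_strictMono_forall_of_extraction hsub hex
  refine ⟨σ, hσ, fun m => ?_⟩
  obtain ⟨⟨u, p⟩, hd⟩ := hgood m
  exact ⟨u, p, fun R hR => hd R hR⟩

/-- **Compactness of suitable weak solutions on the expanding balls `Q(0, a)`**
(Albritton–Barker 2019, Lemma 2.2, applied on every `Q(0, 2ᵐ)` "by rescaling"; Seregin 2014,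
Prop. 6.20: "for each `a > 0`, `u^{(k)} → u` in `L₃(Q(a))` … and `p^{(k)} ⇀ p` in
`L_{3/2}(Q(a))`").  Let `(v_k, q_k)` be suitable weak solutions in every ball `Q(0, 2ᵐ)` (A–B
Def. 2.1) with `sup_k ‖v_k‖_{L³(Q(0,2ᵐ))} + ‖q_k‖_{L^{3/2}(Q(0,2ᵐ))} < ∞` for every `m`.  Then
there are a strictly increasing `σ` and one pair `(u, p)` such that for **every** `a > 0`:
`(u, p)` is a suitable weak solution in `Q(0, a)` (`IsSuitableWeakSolutionInBall a 0 u p`),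
`u ∈ L³(Q(0, a))`, `v_{σ j} → u` in `L³(Q(0, a))`, and `q_{σ j} ⇀ p` weakly in
`L^{3/2}(Q(0, a))` (tested against `L³(Q(0, a))`).  Proof: the level limits of
`slab_suitableCompactness_levels`, zoomed back to the base scale, are limits of the same
sequence on the balls `Q(0, 2ᵐ R)`, `R < 1`; strong `L³` limits and weak limits are unique, so
consecutive levels agree a.e. and glue along the exhaustion `Q(0, 2ᵐ/2)`; the class
`IsSuitableWeakSolutionInBall` is invariant under zooms and a.e. modification.
[cite: AlbrittonBarker2019, Lemma 2.2] -/
theorem slab_suitableCompactness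
    (hball : ∀ k (m : ℕ), IsSuitableWeakSolutionInBall ((2 : ℝ) ^ m) 0 (v k) (q k))
    (hbd : ∀ m : ℕ, (⨆ k, eLpNorm (uncurry (v k)) 3
        (volume.restrict (parabolicCylinder ((2 : ℝ) ^ m) (0 : ℝ × EuclideanSpace ℝ (Fin 3)))) +
      eLpNorm (uncurry (q k)) (3 / 2)
        (volume.restrict (parabolicCylinder ((2 : ℝ) ^ m) (0 : ℝ × EuclideanSpace ℝ (Fin 3))))) < ∞) :
    ∃ (u : ℝ → EuclideanSpace ℝ (Fin 3) → EuclideanSpace ℝ (Fin 3))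
      (p : ℝ → EuclideanSpace ℝ (Fin 3) → ℝ) (σ : ℕ → ℕ), StrictMono σ ∧
      ∀ a : ℝ, 0 < a →
        IsSuitableWeakSolutionInBall a 0 u p ∧
        MemLp (uncurry u) 3
          (volume.restrict (parabolicCylinder a (0 : ℝ × EuclideanSpace ℝ (Fin 3)))) ∧
        Tendsto (fun j => eLpNorm (uncurry (v (σ j)) - uncurry u) 3
            (volume.restrict (parabolicCylinder a (0 : ℝ × EuclideanSpace ℝ (Fin 3)))))
          atTop (𝓝 0) ∧
        ∀ g : ℝ × EuclideanSpace ℝ (Fin 3) → ℝ,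
          MemLp g 3 (volume.restrict (parabolicCylinder a (0 : ℝ × EuclideanSpace ℝ (Fin 3)))) →
          Tendsto (fun j => ∫ w in parabolicCylinder a (0 : ℝ × EuclideanSpace ℝ (Fin 3)),
              q (σ j) w.1 w.2 * g w)
            atTop (𝓝 (∫ w in parabolicCylinder a (0 : ℝ × EuclideanSpace ℝ (Fin 3)),
              p w.1 w.2 * g w)) := by
  classical
  obtain ⟨σ, hσ, hlev⟩ := slab_suitableCompactness_levels hball hbd
  choose u p hgood using hlev
  -- ## abbreviations
  have hcc_pos : ∀ m : ℕ, 0 < ((2 : ℝ) ^ m) := fun m => by positivity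
  set wl : ℕ → ℝ → EuclideanSpace ℝ (Fin 3) → EuclideanSpace ℝ (Fin 3) :=
    fun m => ((2 : ℝ) ^ m)⁻¹ •
      stPull (((2 : ℝ) ^ m)⁻¹ ^ 2) ((2 : ℝ) ^ m)⁻¹ (0 : ℝ) (0 : EuclideanSpace ℝ (Fin 3)) (u m)
    with hwl
  set πl : ℕ → ℝ → EuclideanSpace ℝ (Fin 3) → ℝ :=
    fun m => ((2 : ℝ) ^ m)⁻¹ ^ 2 •
      stPull (((2 : ℝ) ^ m)⁻¹ ^ 2) ((2 : ℝ) ^ m)⁻¹ (0 : ℝ) (0 : EuclideanSpace ℝ (Fin 3)) (p m)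
    with hπl
  -- ## the zoom relations
  have hu_wl : ∀ m, u m = ((2 : ℝ) ^ m) •
      stPull (((2 : ℝ) ^ m) ^ 2) ((2 : ℝ) ^ m) (0 : ℝ) (0 : EuclideanSpace ℝ (Fin 3)) (wl m) :=
    fun m => (zoom_zoom_origin_inv (hcc_pos m).ne' _ _ (mul_inv_cancel₀ (hcc_pos m).ne') (u m)).symm
  have hp_πl : ∀ m, p m =
      ((2 : ℝ) ^ m) ^ 2 •
        stPull (((2 : ℝ) ^ m) ^ 2) ((2 : ℝ) ^ m) (0 : ℝ) (0 : EuclideanSpace ℝ (Fin 3)) (πl m) :=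
    fun m => (zoom_zoom_origin_inv (hcc_pos m).ne' _ _
      (by rw [← mul_pow, mul_inv_cancel₀ (hcc_pos m).ne', one_pow]) (p m)).symm
  have hcyl : ∀ m (R : ℝ), parabolicCylinder R (0 : ℝ × EuclideanSpace ℝ (Fin 3)) =
      parabolicCylinder ((((2 : ℝ) ^ m) * R) / ((2 : ℝ) ^ m)) (0 : ℝ × EuclideanSpace ℝ (Fin 3)) := by
    intro m R; rw [mul_div_cancel_left₀ R (hcc_pos m).ne']
  have hcyl' : ∀ m (R : ℝ), parabolicCylinder (R / ((2 : ℝ) ^ m)⁻¹) (0 : ℝ × EuclideanSpace ℝ (Fin 3)) =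
      parabolicCylinder (((2 : ℝ) ^ m) * R) (0 : ℝ × EuclideanSpace ℝ (Fin 3)) := by
    intro m R; rw [div_inv_eq_mul, mul_comm]
  -- ## (A) strong convergence at level `m`, in the base scale, on `Q(2ᵐ R)`
  have hbase : ∀ m, ∀ R ∈ Ioo (0 : ℝ) 1,
      Tendsto (fun j => eLpNorm (uncurry (v (σ j)) - uncurry (wl m)) 3
        (volume.restrict (parabolicCylinder (((2 : ℝ) ^ m) * R) (0 : ℝ × EuclideanSpace ℝ (Fin 3)))))
        atTop (𝓝 0) := by
    intro m R hR
    obtain ⟨-, -, h3, -⟩ := hgood m R hR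
    set K : ℝ≥0∞ := ‖((2 : ℝ) ^ m)‖ₑ *
      (ENNReal.ofReal (((2 : ℝ) ^ m) ^ 2 * ((2 : ℝ) ^ m) ^ 3)⁻¹) ^ (1 / (3 : ℝ≥0∞).toReal) with hK
    have key : ∀ j, eLpNorm (uncurry (((2 : ℝ) ^ m) • stPull (((2 : ℝ) ^ m) ^ 2) ((2 : ℝ) ^ m) (0 : ℝ)
          (0 : EuclideanSpace ℝ (Fin 3)) (v (σ j))) - uncurry (u m)) 3
        (volume.restrict (parabolicCylinder R (0 : ℝ × EuclideanSpace ℝ (Fin 3)))) =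
        K * eLpNorm (uncurry (v (σ j)) - uncurry (wl m)) 3
          (volume.restrict (parabolicCylinder (((2 : ℝ) ^ m) * R) (0 : ℝ × EuclideanSpace ℝ (Fin 3)))) := by
      intro j
      rw [hu_wl m]
      have e1 : uncurry (((2 : ℝ) ^ m) • stPull (((2 : ℝ) ^ m) ^ 2) ((2 : ℝ) ^ m) (0 : ℝ)
            (0 : EuclideanSpace ℝ (Fin 3)) (v (σ j))) -
          uncurry (((2 : ℝ) ^ m) • stPull (((2 : ℝ) ^ m) ^ 2) ((2 : ℝ) ^ m) (0 : ℝ)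
            (0 : EuclideanSpace ℝ (Fin 3)) (wl m)) =
          uncurry (((2 : ℝ) ^ m) • stPull (((2 : ℝ) ^ m) ^ 2) ((2 : ℝ) ^ m) (0 : ℝ)
            (0 : EuclideanSpace ℝ (Fin 3)) (v (σ j) - wl m)) := by
        funext z
        show _ - _ = ((2 : ℝ) ^ m) • (v (σ j) - wl m) _ _
        rw [Pi.sub_apply, Pi.sub_apply, smul_sub]
        rfl
      rw [e1, hcyl m R, eLpNorm_uncurry_zoom (hcc_pos m) ((2 : ℝ) ^ m) _ (((2 : ℝ) ^ m) * R) (by norm_num)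
        (by norm_num)]
      rfl
    have hK0 : K ≠ 0 := by
      refine mul_ne_zero ?_ ?_
      · rw [Real.enorm_eq_ofReal (hcc_pos m).le]; exact (ENNReal.ofReal_pos.2 (hcc_pos m)).ne'
      · exact (ENNReal.rpow_pos (ENNReal.ofReal_pos.2 (by positivity)) ENNReal.ofReal_ne_top).ne'
    have hKtop : K ≠ ⊤ :=
      ENNReal.mul_ne_top enorm_ne_top (ENNReal.rpow_ne_top_of_nonneg (by positivity) ENNReal.ofReal_ne_top)
    have h3' : Tendsto (fun j => K * eLpNorm (uncurry (v (σ j)) - uncurry (wl m)) 3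
        (volume.restrict (parabolicCylinder (((2 : ℝ) ^ m) * R) (0 : ℝ × EuclideanSpace ℝ (Fin 3)))))
        atTop (𝓝 0) := by
      simpa only [key] using h3
    have h4 := ENNReal.Tendsto.const_mul h3' (Or.inr (ENNReal.inv_ne_top.2 hK0)) (a := K⁻¹)
    simp only [mul_zero, ← mul_assoc, ENNReal.inv_mul_cancel hK0 hKtop, one_mul] at h4
    exact h4
  -- ## (B) weak convergence of the pressures at level `m`, in the base scale, on `Q(2ᵐ R)`
  have hweak : ∀ m, ∀ R ∈ Ioo (0 : ℝ) 1, ∀ g : ℝ × EuclideanSpace ℝ (Fin 3) → ℝ,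
      MemLp g 3 (volume.restrict (parabolicCylinder (((2 : ℝ) ^ m) * R) (0 : ℝ × EuclideanSpace ℝ (Fin 3)))) →
      Tendsto (fun j => ∫ w in parabolicCylinder (((2 : ℝ) ^ m) * R) (0 : ℝ × EuclideanSpace ℝ (Fin 3)),
          q (σ j) w.1 w.2 * g w) atTop
        (𝓝 (∫ w in parabolicCylinder (((2 : ℝ) ^ m) * R) (0 : ℝ × EuclideanSpace ℝ (Fin 3)),
          (πl m) w.1 w.2 * g w)) := by
    intro m R hR g hg
    obtain ⟨-, -, -, h4⟩ := hgood m R hR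
    have hg' : MemLp (g ∘ stAffine (((2 : ℝ) ^ m) ^ 2) ((2 : ℝ) ^ m) (0 : ℝ) (0 : EuclideanSpace ℝ (Fin 3))) 3
        (volume.restrict (parabolicCylinder R (0 : ℝ × EuclideanSpace ℝ (Fin 3)))) := by
      rw [hcyl m R]
      exact memLp_comp_zoom (hcc_pos m) (by norm_num) (by norm_num) hg
    have h5 := h4 _ hg'
    set K : ℝ := ((2 : ℝ) ^ m) ^ 2 * (((2 : ℝ) ^ m) ^ 2 * ((2 : ℝ) ^ m) ^ 3)⁻¹ with hK
    have hK0 : K ≠ 0 := by positivity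
    have key : ∀ ρ : ℝ → EuclideanSpace ℝ (Fin 3) → ℝ,
        ∫ w in parabolicCylinder R (0 : ℝ × EuclideanSpace ℝ (Fin 3)),
          (((2 : ℝ) ^ m) ^ 2 • stPull (((2 : ℝ) ^ m) ^ 2) ((2 : ℝ) ^ m) (0 : ℝ)
            (0 : EuclideanSpace ℝ (Fin 3)) ρ) w.1 w.2 *
            (g ∘ stAffine (((2 : ℝ) ^ m) ^ 2) ((2 : ℝ) ^ m) (0 : ℝ) (0 : EuclideanSpace ℝ (Fin 3))) w =
          K * ∫ w in parabolicCylinder (((2 : ℝ) ^ m) * R) (0 : ℝ × EuclideanSpace ℝ (Fin 3)),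
            ρ w.1 w.2 * g w := by
      intro ρ
      rw [hcyl m R]
      exact setIntegral_zoom_pressure_mul (hcc_pos m) _ ρ g (((2 : ℝ) ^ m) * R)
    simp only [hp_πl m, key] at h5
    have h6 := h5.const_mul K⁻¹
    simp only [← mul_assoc, inv_mul_cancel₀ hK0, one_mul] at h6
    exact h6
  -- ## measurability and integrability
  have hv_meas : ∀ j m, ∀ R ∈ Ioo (0 : ℝ) 1, AEStronglyMeasurable (uncurry (v j))
      (volume.restrict (parabolicCylinder (((2 : ℝ) ^ m) * R) (0 : ℝ × EuclideanSpace ℝ (Fin 3)))) := by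
    intro j m R hR
    have h1 := (hball j m).1.distributional.1.aestronglyMeasurable
    refine h1.mono_measure (Measure.restrict_mono ?_ le_rfl)
    refine parabolicCylinder_mono (by have := hcc_pos m; have := hR.1; positivity) ?_ _
    have := hR.2
    nlinarith [hcc_pos m]
  have hwl_memLp : ∀ m, ∀ R ∈ Ioo (0 : ℝ) 1, MemLp (uncurry (wl m)) 3
      (volume.restrict (parabolicCylinder (((2 : ℝ) ^ m) * R) (0 : ℝ × EuclideanSpace ℝ (Fin 3)))) := by
    intro m R hR
    obtain ⟨-, h2, -, -⟩ := hgood m R hR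
    have h1 := (memLp_comp_zoom (inv_pos.2 (hcc_pos m)) (by norm_num) (by norm_num) h2).const_smul
      ((2 : ℝ) ^ m)⁻¹
    rw [hcyl'] at h1
    exact h1
  have hπl_memLp : ∀ m, ∀ R ∈ Ioo (0 : ℝ) 1, MemLp (uncurry (πl m)) (3 / 2)
      (volume.restrict (parabolicCylinder (((2 : ℝ) ^ m) * R) (0 : ℝ × EuclideanSpace ℝ (Fin 3)))) := by
    intro m R hR
    obtain ⟨h1, -, -, -⟩ := hgood m R hR
    have h2 := (memLp_comp_zoom (inv_pos.2 (hcc_pos m)) (by norm_num)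
      (ENNReal.div_ne_top (by norm_num) (by norm_num)) h1.2.2.2).const_smul (((2 : ℝ) ^ m)⁻¹ ^ 2)
    rw [hcyl'] at h2
    exact h2
  -- ## (C) consecutive levels agree a.e.
  have hstep_cyl : ∀ m (R : ℝ), ((2 : ℝ) ^ (m + 1)) * (R / 2) = ((2 : ℝ) ^ m) * R := by
    intro m R; rw [pow_succ]; ring
  have hcons_w : ∀ m, ∀ R ∈ Ioo (0 : ℝ) 1,
      ∀ᵐ z ∂(volume.restrict (parabolicCylinder (((2 : ℝ) ^ m) * R) (0 : ℝ × EuclideanSpace ℝ (Fin 3)))),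
        uncurry (wl m) z = uncurry (wl (m + 1)) z := by
    intro m R hR
    have hR2 : R / 2 ∈ Ioo (0 : ℝ) 1 := ⟨by linarith [hR.1], by linarith [hR.2]⟩
    have h1 := hbase m R hR
    have h2 := hbase (m + 1) (R / 2) hR2
    have hm2 := hwl_memLp (m + 1) (R / 2) hR2
    rw [hstep_cyl] at h2 hm2
    exact ae_eq_of_tendsto_eLpNorm_sub (by norm_num) (fun j => hv_meas (σ j) m R hR)
      (hwl_memLp m R hR).1 hm2.1 h1 h2
  have hcons_π : ∀ m, ∀ R ∈ Ioo (0 : ℝ) 1,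
      ∀ᵐ z ∂(volume.restrict (parabolicCylinder (((2 : ℝ) ^ m) * R) (0 : ℝ × EuclideanSpace ℝ (Fin 3)))),
        uncurry (πl m) z = uncurry (πl (m + 1)) z := by
    intro m R hR
    have hR2 : R / 2 ∈ Ioo (0 : ℝ) 1 := ⟨by linarith [hR.1], by linarith [hR.2]⟩
    have hm2 := hπl_memLp (m + 1) (R / 2) hR2
    rw [hstep_cyl] at hm2
    refine ae_eq_of_forall_setIntegral_mul_eq (hπl_memLp m R hR) hm2 fun g hg => ?_
    have h1 := hweak m R hR g hg
    have h2 := hweak (m + 1) (R / 2) hR2 g (by rw [hstep_cyl]; exact hg)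
    rw [hstep_cyl] at h2
    exact tendsto_nhds_unique h1 h2
  -- iterated consistency
  have hcons_w' : ∀ n m, n ≤ m → ∀ R ∈ Ioo (0 : ℝ) 1,
      ∀ᵐ z ∂(volume.restrict (parabolicCylinder (((2 : ℝ) ^ n) * R) (0 : ℝ × EuclideanSpace ℝ (Fin 3)))),
        uncurry (wl n) z = uncurry (wl m) z := by
    intro n m hnm R hR
    induction m, hnm using Nat.le_induction with
    | base => exact ae_of_all _ fun z => rfl
    | succ m hnm ih =>
        have hsub : parabolicCylinder (((2 : ℝ) ^ n) * R) (0 : ℝ × EuclideanSpace ℝ (Fin 3)) ⊆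
            parabolicCylinder (((2 : ℝ) ^ m) * R) (0 : ℝ × EuclideanSpace ℝ (Fin 3)) :=
          parabolicCylinder_mono (by have := hcc_pos n; have := hR.1; positivity)
            (mul_le_mul_of_nonneg_right (pow_le_pow_right₀ (by norm_num) hnm) hR.1.le) _
        filter_upwards [ih, ae_restrict_of_ae_restrict_of_subset hsub (hcons_w m R hR)] with z h1 h2
        rw [h1, h2]
  have hcons_π' : ∀ n m, n ≤ m → ∀ R ∈ Ioo (0 : ℝ) 1,
      ∀ᵐ z ∂(volume.restrict (parabolicCylinder (((2 : ℝ) ^ n) * R) (0 : ℝ × EuclideanSpace ℝ (Fin 3)))),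
        uncurry (πl n) z = uncurry (πl m) z := by
    intro n m hnm R hR
    induction m, hnm using Nat.le_induction with
    | base => exact ae_of_all _ fun z => rfl
    | succ m hnm ih =>
        have hsub : parabolicCylinder (((2 : ℝ) ^ n) * R) (0 : ℝ × EuclideanSpace ℝ (Fin 3)) ⊆
            parabolicCylinder (((2 : ℝ) ^ m) * R) (0 : ℝ × EuclideanSpace ℝ (Fin 3)) :=
          parabolicCylinder_mono (by have := hcc_pos n; have := hR.1; positivity)
            (mul_le_mul_of_nonneg_right (pow_le_pow_right₀ (by norm_num) hnm) hR.1.le) _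
        filter_upwards [ih, ae_restrict_of_ae_restrict_of_subset hsub (hcons_π m R hR)] with z h1 h2
        rw [h1, h2]
  -- ## (D) gluing along the exhaustion `Q(2ᵐ / 2)`
  have hhalf : ∀ m, ((2 : ℝ) ^ m) * (1 / 2) = ((2 : ℝ) ^ m) / 2 := fun m => by ring
  have hSm : ∀ m, MeasurableSet (parabolicCylinder (((2 : ℝ) ^ m) / 2) (0 : ℝ × EuclideanSpace ℝ (Fin 3))) :=
    fun m => (isOpen_parabolicCylinder _ _).measurableSet
  set N : ℝ × EuclideanSpace ℝ (Fin 3) → ℕ := fun z =>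
    if h : ∃ m : ℕ, z ∈ parabolicCylinder (((2 : ℝ) ^ m) / 2) (0 : ℝ × EuclideanSpace ℝ (Fin 3))
    then Nat.find h else 0 with hN
  have hNS : ∀ z ∈ ⋃ m : ℕ, parabolicCylinder (((2 : ℝ) ^ m) / 2) (0 : ℝ × EuclideanSpace ℝ (Fin 3)),
      z ∈ parabolicCylinder (((2 : ℝ) ^ (N z)) / 2) (0 : ℝ × EuclideanSpace ℝ (Fin 3)) := by
    intro z hz
    have h : ∃ m : ℕ, z ∈ parabolicCylinder (((2 : ℝ) ^ m) / 2) (0 : ℝ × EuclideanSpace ℝ (Fin 3)) :=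
      mem_iUnion.1 hz
    simp only [hN, dif_pos h]
    exact Nat.find_spec h
  have hNle : ∀ m, ∀ z ∈ parabolicCylinder (((2 : ℝ) ^ m) / 2) (0 : ℝ × EuclideanSpace ℝ (Fin 3)),
      N z ≤ m := by
    intro m z hz
    have h : ∃ m : ℕ, z ∈ parabolicCylinder (((2 : ℝ) ^ m) / 2) (0 : ℝ × EuclideanSpace ℝ (Fin 3)) :=
      ⟨m, hz⟩
    simp only [hN, dif_pos h]
    exact Nat.find_min' h hz
  have hcw : ∀ n m, n ≤ m → ∀ᵐ z ∂(volume.restrict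
      (parabolicCylinder (((2 : ℝ) ^ n) / 2) (0 : ℝ × EuclideanSpace ℝ (Fin 3)))),
      uncurry (wl n) z = uncurry (wl m) z := fun n m hnm => by
    have h := hcons_w' n m hnm (1 / 2) (by norm_num); rwa [hhalf] at h
  have hcπ : ∀ n m, n ≤ m → ∀ᵐ z ∂(volume.restrict
      (parabolicCylinder (((2 : ℝ) ^ n) / 2) (0 : ℝ × EuclideanSpace ℝ (Fin 3)))),
      uncurry (πl n) z = uncurry (πl m) z := fun n m hnm => by
    have h := hcons_π' n m hnm (1 / 2) (by norm_num); rwa [hhalf] at h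
  obtain ⟨W, hW, -⟩ := FunctionSpaces.exists_glue_of_ae_eq
    (μ := (volume : Measure (ℝ × EuclideanSpace ℝ (Fin 3)))) hSm N hNS hNle (fun m => uncurry (wl m)) hcw
  obtain ⟨Pg, hPg, -⟩ := FunctionSpaces.exists_glue_of_ae_eq
    (μ := (volume : Measure (ℝ × EuclideanSpace ℝ (Fin 3)))) hSm N hNS hNle (fun m => uncurry (πl m)) hcπ
  set w : ℝ → EuclideanSpace ℝ (Fin 3) → EuclideanSpace ℝ (Fin 3) := fun s y => W (s, y) with hw
  set π : ℝ → EuclideanSpace ℝ (Fin 3) → ℝ := fun s y => Pg (s, y) with hπ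
  -- ## the conclusion on an arbitrary ball `Q(0, a)`
  refine ⟨w, π, σ, hσ, fun a ha => ?_⟩
  obtain ⟨m, hm⟩ := pow_unbounded_of_one_lt (2 * a) (by norm_num : (1 : ℝ) < 2)
  have hm' : a < ((2 : ℝ) ^ m) / 2 := by linarith
  set R : ℝ := a / ((2 : ℝ) ^ m) with hRdef
  have hR : R ∈ Ioo (0 : ℝ) 1 := by
    refine ⟨div_pos ha (hcc_pos m), ?_⟩
    rw [hRdef, div_lt_one (hcc_pos m)]
    linarith [hcc_pos m]
  have hcR : ((2 : ℝ) ^ m) * R = a := by rw [hRdef, mul_div_cancel₀ a (hcc_pos m).ne']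
  have hsubQ : parabolicCylinder a (0 : ℝ × EuclideanSpace ℝ (Fin 3)) ⊆
      parabolicCylinder (((2 : ℝ) ^ m) / 2) (0 : ℝ × EuclideanSpace ℝ (Fin 3)) :=
    parabolicCylinder_mono ha.le hm'.le _
  have hw_a : ∀ᵐ z ∂(volume.restrict (parabolicCylinder a (0 : ℝ × EuclideanSpace ℝ (Fin 3)))),
      uncurry (wl m) z = uncurry w z := by
    filter_upwards [ae_restrict_of_ae_restrict_of_subset hsubQ (hW m)] with z hz
    rw [← hz]
    rfl
  have hπ_a : ∀ᵐ z ∂(volume.restrict (parabolicCylinder a (0 : ℝ × EuclideanSpace ℝ (Fin 3)))),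
      uncurry (πl m) z = uncurry π z := by
    filter_upwards [ae_restrict_of_ae_restrict_of_subset hsubQ (hPg m)] with z hz
    rw [← hz]
    rfl
  obtain ⟨h1, -, -, -⟩ := hgood m R hR
  refine ⟨?_, ?_, ?_, ?_⟩
  · -- suitability
    have h2 := h1.zoomOut (inv_pos.2 (hcc_pos m))
    have e : R / ((2 : ℝ) ^ m)⁻¹ = a := by rw [div_inv_eq_mul, mul_comm, hcR]
    rw [e] at h2
    exact h2.congr_ae' hw_a hπ_a
  · -- `w ∈ L³(Q(0, a))`
    have h2 := hwl_memLp m R hR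
    rw [hcR] at h2
    exact h2.ae_eq hw_a
  · -- strong convergence of the velocities
    have h2 := hbase m R hR
    rw [hcR] at h2
    refine (tendsto_congr fun j => ?_).1 h2
    refine eLpNorm_congr_ae ?_
    filter_upwards [hw_a] with z hz
    show uncurry (v (σ j)) z - uncurry (wl m) z = uncurry (v (σ j)) z - uncurry w z
    rw [hz]
  · -- weak convergence of the pressures
    intro g hg
    have hg' : MemLp g 3 (volume.restrict (parabolicCylinder (((2 : ℝ) ^ m) * R)
        (0 : ℝ × EuclideanSpace ℝ (Fin 3)))) := by rw [hcR]; exact hg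
    have h2 := hweak m R hR g hg'
    rw [hcR] at h2
    have e : ∫ w' in parabolicCylinder a (0 : ℝ × EuclideanSpace ℝ (Fin 3)), (πl m) w'.1 w'.2 * g w' =
        ∫ w' in parabolicCylinder a (0 : ℝ × EuclideanSpace ℝ (Fin 3)), π w'.1 w'.2 * g w' := by
      refine integral_congr_ae ?_
      filter_upwards [hπ_a] with z hz
      change (πl m) z.1 z.2 = π z.1 z.2 at hz
      rw [hz]
    rwa [e] at h2

end SlabCompactness

end Literature.Analysis.FluidPDE
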